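import Literature.AlgebraicGeometry.Motives.HodgeLieWeightOneSl2Triple
import Literature.RepresentationTheory.GeneralLinear.SL2TripleCommutant
import HarnessLib

/-!
# Weight-one Hodge structures with `dim Hg ≤ 3` which are not of CM type: `dim_ℚ End_Hdg(V) = g²` (`2g = dim V`) and
# `End_Hdg(V)` has centre `ℚ`

Family `hodge`, layer `Literature/AlgebraicGeometry/Motives`; THEOREMS ONLY (no definition, no named fact; D-0026).
Part 2 of the abstract heart of the cell `pub-hodgecm2` (COR-CM) lane MT-RANK-FOUR (the rung `dim MT(H¹(X)) = 4` of the
Mumford–Tate rank ladder WITHOUT a CM hypothesis); part 1 is `Motives/HodgeLieWeightOneSl2Triple`, the geometric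
reading `Summits/HodgeConjecture/CorCM/MumfordTateRankFour`.

SETTING.  `H` a pure `ℚ`-Hodge structure of weight `n = 1` on a finite-dimensional `V ≠ 0`, EFFECTIVE (`V_ℂ = V^{1,0} ⊕
V^{0,1}`), with a polarization `ψ`; `𝔥 = H.hodgeLie = Lie Hg(H)`, `𝔪𝔱 = H.mumfordTateLieAlgebra`, `End_Hdg(V) = H.endAlg`.
Hypotheses: **`dim_ℚ 𝔥 ≤ 3` and `𝔥 ⊄ End_Hdg(V)`** (§3: equivalently `dim MT(H) ≤ 4` and `𝔪𝔱 ⊄ End_Hdg(V)`, by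
`Motives/HodgeLieRankLowerBound`; on `H¹` of an abelian variety: `dim MT = 4` and not of CM type).

* §2 `finrank_hodgeLie_eq_three`; **`four_mul_finrank_endAlg_eq_sq`** — `4 · dim_ℚ End_Hdg(V) = (dim_ℚ V)²`, i.e.
  `dim End_Hdg(V) = g²` with `dim V = 2g` (`exists_finrank_endAlg_eq_sq`): by part 1, `End_Hdg(V) ⊗ ℂ` is the commutant of
  an `𝔰𝔩₂`-triple `(P, E, F)` in isotypic position, which is `End_ℂ(V^{1,0})`
  (`RepresentationTheory/GeneralLinear/SL2TripleCommutant`), and `2 dim V^{1,0} = dim V`;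
  **`exists_eq_smul_one_of_mem_center_endAlg`** — the centre of `End_Hdg(V)` is `ℚ · 1` (scalar centre of the
  commutant, then descent `ℂ → ℚ` by `mem_of_one_tmul_mem_baseChange`).
* §3 `finrank_endAlg_of_mtRank_le_four` (`dim Hg = 3`, `dim MT = 4`, `4 dim End_Hdg = (dim V)²`),
  `exists_eq_smul_one_of_mem_center_endAlg_of_mtRank_le_four`.

Classically: a polarizable weight-one Hodge structure whose Hodge group has dimension `≤ 3` and is not a torus has
`Hg_ℂ = SL₂` acting on `V_ℂ = std ⊗ W₁`, so `End_Hdg(V)` is a `ℚ`-form of `M_g(ℂ)`: a central simple `ℚ`-algebra of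
degree `g` (for `H = H¹(X)`: `X` is isogenous to a power of a non-CM elliptic curve or of an abelian surface with
quaternionic multiplication; Moonen–Zarhin 1999 §2).  No structure theory of algebraic groups is used.

## References

* [MoonenZarhin1999LowDim] B. Moonen, Yu. Zarhin, *Hodge classes on abelian varieties of low dimension*, Math. Ann. 315
  (1999), §2 (Hodge group, `MT = 𝔾ₘ·Hg`, `End⁰(X) = End_{Hg}(H¹)`; (2.3)–(2.5)).
* [Deligne1982HodgeCycles] P. Deligne, *Hodge cycles on abelian varieties*, LNM 900 (1982), I §3 (3.1–3.4).
* [FultonHarris1991] W. Fulton, J. Harris, *Representation Theory*, GTM 129 (1991), Lecture 11 (§11.1).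
* [Humphreys1972] J. E. Humphreys, *Introduction to Lie Algebras and Representation Theory* (1972), §6.1 (Schur).
-/

noncomputable section

open scoped TensorProduct

namespace Literature.AlgebraicGeometry.Motives

universe u

namespace HodgeStructure

open Literature.RepresentationTheory.GeneralLinear

variable {V : Type u} [AddCommGroup V] [Module ℚ V] [Module.Finite ℚ V] [HodgeTensorFacts.{u, u}] {n : ℤ}
  {S : Type u} [Fintype S] [DecidableEq S] {deg : S → ℤ}

/-! ## §2 `dim_ℚ End_Hdg(V) = g²` and the centre of `End_Hdg(V)` is `ℚ` -/

omit [Module.Finite ℚ V] [HodgeTensorFacts.{u, u}] [Fintype S] [DecidableEq S] in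
/-- Degrees of a graded basis adapted to an effective Hodge structure of weight `1` are `0` or `1`. [folklore] -/
private theorem deg_eq_zero_or_one {H : HodgeStructure V n} (hH : H.IsEffective) (hn : n = 1)
    (e : Module.Basis S ℂ (ℂ ⊗[ℚ] V)) (hF : ∀ a, H.F a = Submodule.span ℂ (e '' {σ | a ≤ deg σ}))
    (hFc : ∀ a, complexConj (H.F a) = Submodule.span ℂ (e '' {σ | deg σ ≤ n - a})) (σ : S) :
    deg σ = 0 ∨ deg σ = 1 := by
  have h := hH.deg_mem_Icc_of_graded e hF hFc σ
  omega

/-- **`dim Hg(H) = 3`** for a polarizable effective weight-one `H` with `dim Hg(H) ≤ 3` and `Lie Hg ⊄ End_Hdg(V)`.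
[cite: MoonenZarhin1999LowDim, §2] -/
theorem finrank_hodgeLie_eq_three (H : HodgeStructure V n) (hne : ¬ H.hodgeLie ≤ Subalgebra.toSubmodule H.endAlg)
    (h3 : Module.finrank ℚ H.hodgeLie ≤ 3) : Module.finrank ℚ H.hodgeLie = 3 := by
  obtain ⟨X, hX, hXE⟩ := SetLike.not_le_iff_exists.1 hne
  have h := three_le_finrank_hodgeLie_of_not_mem_endAlg H hX hXE
  omega

/-- **`4 · dim_ℚ End_Hdg(V) = (dim_ℚ V)²`** — i.e. `dim_ℚ End_Hdg(V) = g²` with `dim V = 2g` — for a polarizable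
effective Hodge structure of weight `1` with `dim Hg(H) ≤ 3` whose Hodge Lie algebra is not contained in `End_Hdg(V)`
(not "of CM type"): `End_Hdg(V) ⊗ ℂ` is the commutant of the `𝔰𝔩₂`-triple `(P, E, F)` in isotypic position, which is
`End_ℂ(V^{1,0})` (`SL2Triple.finrank_commutant_eq_sq`), and `2 dim V^{1,0} = dim V`.  Classically: `Hg_ℂ = SL₂`,
`V_ℂ = std ⊗ W₁`, `End_Hdg ⊗ ℂ = M_g(ℂ)`. [cite: MoonenZarhin1999LowDim, §2] [cite: FultonHarris1991, Lecture 11 (§11.1)] -/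
theorem four_mul_finrank_endAlg_eq_sq [Nontrivial V] (H : HodgeStructure V n) (ψ : H.Polarization) (hn : n = 1)
    (hH : H.IsEffective) (hne : ¬ H.hodgeLie ≤ Subalgebra.toSubmodule H.endAlg)
    (h3 : Module.finrank ℚ H.hodgeLie ≤ 3) :
    4 * Module.finrank ℚ H.endAlg = (Module.finrank ℚ V) ^ 2 := by
  classical
  obtain ⟨X, hX, hXE⟩ := SetLike.not_le_iff_exists.1 hne
  rw [Subalgebra.mem_toSubmodule] at hXE
  obtain ⟨S, deg, e, hF, hFc⟩ := exists_basis_F_eq_span H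
  haveI : Fintype S := FiniteDimensional.fintypeBasisIndex e
  have hdeg : ∀ σ, deg σ = 0 ∨ deg σ = 1 := deg_eq_zero_or_one hH hn e hF hFc
  obtain ⟨α, hα, hEF, hFE⟩ := exists_projE_mul_projF_eq_smul H ψ hn e hF hFc hdeg hX hXE h3
  have h2r := two_mul_finrank_range_gradingEnd H ψ hn e hF hFc hdeg hX hXE h3
  set P := gradingEnd e deg with hP
  set Y := X.baseChange ℂ with hY
  have hPP : P * P = P := gradingEnd_mul_gradingEnd_of_deg e hdeg
  have hPE : P * (P * Y * (1 - P)) = P * Y * (1 - P) := by rw [← mul_assoc, ← mul_assoc, hPP]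
  have hEP : P * Y * (1 - P) * P = 0 := by
    rw [mul_assoc (P * Y) (1 - P) P, sub_mul, one_mul, hPP, sub_self, mul_zero]
  have hPF : P * ((1 - P) * Y * P) = 0 := by
    rw [mul_assoc (1 - P) Y P, ← mul_assoc P (1 - P) (Y * P), mul_sub, mul_one, hPP, sub_self, zero_mul]
  have hFP : (1 - P) * Y * P * P = (1 - P) * Y * P := by rw [mul_assoc ((1 - P) * Y) P P, hPP]
  have hC := mem_span_endAlg_iff_commute H hn e hF hFc hdeg hX hXE h3
  have hsq := SL2Triple.finrank_commutant_eq_sq hα hPP hPE hEP hPF hFP hEF hFE hC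
  have hspan := finrank_span_baseChange_image (Subalgebra.toSubmodule H.endAlg)
  rw [Subalgebra.coe_toSubmodule, Subalgebra.finrank_toSubmodule] at hspan
  rw [hspan] at hsq
  rw [hsq, ← h2r]
  ring

/-- **`dim_ℚ End_Hdg(V) = g²` with `dim_ℚ V = 2g`**, existential form of `four_mul_finrank_endAlg_eq_sq`.
[cite: MoonenZarhin1999LowDim, §2] -/
theorem exists_finrank_endAlg_eq_sq [Nontrivial V] (H : HodgeStructure V n) (ψ : H.Polarization) (hn : n = 1)
    (hH : H.IsEffective) (hne : ¬ H.hodgeLie ≤ Subalgebra.toSubmodule H.endAlg)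
    (h3 : Module.finrank ℚ H.hodgeLie ≤ 3) :
    ∃ g : ℕ, Module.finrank ℚ V = 2 * g ∧ Module.finrank ℚ H.endAlg = g ^ 2 := by
  classical
  obtain ⟨X, hX, hXE⟩ := SetLike.not_le_iff_exists.1 hne
  rw [Subalgebra.mem_toSubmodule] at hXE
  obtain ⟨S, deg, e, hF, hFc⟩ := exists_basis_F_eq_span H
  haveI : Fintype S := FiniteDimensional.fintypeBasisIndex e
  have hdeg : ∀ σ, deg σ = 0 ∨ deg σ = 1 := deg_eq_zero_or_one hH hn e hF hFc
  have h2r := two_mul_finrank_range_gradingEnd H ψ hn e hF hFc hdeg hX hXE h3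
  have h4 := four_mul_finrank_endAlg_eq_sq H ψ hn hH hne h3
  refine ⟨Module.finrank ℂ (LinearMap.range (gradingEnd e deg)), h2r.symm, ?_⟩
  rw [← h2r] at h4
  have h : 4 * Module.finrank ℚ H.endAlg = 4 * Module.finrank ℂ (LinearMap.range (gradingEnd e deg)) ^ 2 := by
    rw [h4]; ring
  omega

/-- **The centre of `End_Hdg(V)` is `ℚ`**: in the same setting, a Hodge endomorphism commuting with all Hodge
endomorphisms is a rational scalar (`End_Hdg(V) ⊗ ℂ ≅ M_g(ℂ)` has centre `ℂ`: `SL2Triple.exists_eq_smul_one_of_mem_center_commutant`;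
descent to `ℚ` by `mem_of_one_tmul_mem_baseChange`). [cite: MoonenZarhin1999LowDim, §2] [cite: Humphreys1972, §6.1] -/
theorem exists_eq_smul_one_of_mem_center_endAlg [Nontrivial V] (H : HodgeStructure V n) (ψ : H.Polarization)
    (hn : n = 1) (hH : H.IsEffective) (hne : ¬ H.hodgeLie ≤ Subalgebra.toSubmodule H.endAlg)
    (h3 : Module.finrank ℚ H.hodgeLie ≤ 3) {z : Module.End ℚ V} (hz : z ∈ H.endAlg)
    (hzc : ∀ a ∈ H.endAlg, z * a = a * z) : ∃ q : ℚ, z = q • 1 := by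
  classical
  obtain ⟨X, hX, hXE⟩ := SetLike.not_le_iff_exists.1 hne
  rw [Subalgebra.mem_toSubmodule] at hXE
  obtain ⟨S, deg, e, hF, hFc⟩ := exists_basis_F_eq_span H
  haveI : Fintype S := FiniteDimensional.fintypeBasisIndex e
  have hdeg : ∀ σ, deg σ = 0 ∨ deg σ = 1 := deg_eq_zero_or_one hH hn e hF hFc
  obtain ⟨α, hα, hEF, hFE⟩ := exists_projE_mul_projF_eq_smul H ψ hn e hF hFc hdeg hX hXE h3
  obtain ⟨hE0, -⟩ := projE_ne_zero_of_not_mem_endAlg H hn e hF hFc hdeg hXE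
  set P := gradingEnd e deg with hP
  set Y := X.baseChange ℂ with hY
  have hPP : P * P = P := gradingEnd_mul_gradingEnd_of_deg e hdeg
  have hPE : P * (P * Y * (1 - P)) = P * Y * (1 - P) := by rw [← mul_assoc, ← mul_assoc, hPP]
  have hEP : P * Y * (1 - P) * P = 0 := by
    rw [mul_assoc (P * Y) (1 - P) P, sub_mul, one_mul, hPP, sub_self, mul_zero]
  have hPF : P * ((1 - P) * Y * P) = 0 := by
    rw [mul_assoc (1 - P) Y P, ← mul_assoc P (1 - P) (Y * P), mul_sub, mul_one, hPP, sub_self, zero_mul]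
  have hFP : (1 - P) * Y * P * P = (1 - P) * Y * P := by rw [mul_assoc ((1 - P) * Y) P P, hPP]
  have hP0 : P ≠ 0 := by
    intro h
    apply hE0
    rw [h, zero_mul, zero_mul]
  have hC := mem_span_endAlg_iff_commute H hn e hF hFc hdeg hX hXE h3
  -- `z_ℂ` is central in the commutant
  have hzC : z.baseChange ℂ ∈ Submodule.span ℂ
      ((fun a : Module.End ℚ V => a.baseChange ℂ) '' (H.endAlg : Set (Module.End ℚ V))) :=
    Submodule.subset_span ⟨z, hz, rfl⟩
  have hzcomm : ∀ T' ∈ Submodule.span ℂ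
      ((fun a : Module.End ℚ V => a.baseChange ℂ) '' (H.endAlg : Set (Module.End ℚ V))),
      z.baseChange ℂ * T' = T' * z.baseChange ℂ := by
    intro T' hT'
    induction hT' using Submodule.span_induction with
    | mem T'' hT'' =>
      obtain ⟨a, ha, rfl⟩ := hT''
      rw [← LinearMap.baseChange_mul, ← LinearMap.baseChange_mul, hzc a ha]
    | zero => rw [zero_mul, mul_zero]
    | add T₁ T₂ _ _ h₁ h₂ => rw [add_mul, mul_add, h₁, h₂]
    | smul c T₁ _ h₁ => rw [smul_mul_assoc, mul_smul_comm, h₁]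
  obtain ⟨c, hc⟩ := SL2Triple.exists_eq_smul_one_of_mem_center_commutant hα hPP hPE hEP hPF hFP hEF hFE hP0 hC
    hzC hzcomm
  -- descent: `1 ⊗ z = c ⊗ 1` in `ℂ ⊗ End_ℚ V`, so `z ∈ ℚ · 1`
  have hmem : z ∈ ℚ ∙ (1 : Module.End ℚ V) := by
    apply mem_of_one_tmul_mem_baseChange
    have key : ((1 : ℂ) ⊗ₜ[ℚ] z : ℂ ⊗[ℚ] Module.End ℚ V) = c • ((1 : ℂ) ⊗ₜ[ℚ] (1 : Module.End ℚ V)) := by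
      apply (endBaseChangeEquiv V).injective
      rw [map_smul, endBaseChangeEquiv_tmul, endBaseChangeEquiv_tmul, one_smul, one_smul, hc,
        Module.End.one_eq_id, Module.End.one_eq_id, LinearMap.baseChange_id]
    rw [key]
    exact Submodule.smul_mem _ _ (Submodule.tmul_mem_baseChange_of_mem 1 (Submodule.mem_span_singleton_self _))
  obtain ⟨q, hq⟩ := Submodule.mem_span_singleton.1 hmem
  exact ⟨q, hq.symm⟩

/-! ## §3 The same under `dim MT(H) ≤ 4`, `Lie MT ⊄ End_Hdg(V)` -/

/-- **`dim MT(H) ≤ 4` and `𝔪𝔱 ⊄ End_Hdg(V)` ⟹ `dim Hg(H) = 3`, `dim MT(H) = 4`, `4 · dim End_Hdg(V) = (dim V)²`**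
(polarizable effective weight-one `H`): `dim Hg + 1 ≤ dim MT` (`finrank_hodgeLie_add_one_le_mtRank`) and `𝔥 ⊆ End_Hdg
⟺ 𝔪𝔱 ⊆ End_Hdg` (`hodgeLie_le_endAlg_iff`). [cite: MoonenZarhin1999LowDim, §2] [cite: Deligne1982HodgeCycles, I Prop. 3.4] -/
theorem finrank_endAlg_of_mtRank_le_four [Nontrivial V] (H : HodgeStructure V n) (ψ : H.Polarization) (hn : n = 1)
    (hH : H.IsEffective) (hne : ¬ H.mumfordTateLieAlgebra ≤ Subalgebra.toSubmodule H.endAlg) (h4 : H.mtRank ≤ 4) :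
    Module.finrank ℚ H.hodgeLie = 3 ∧ H.mtRank = 4 ∧ 4 * Module.finrank ℚ H.endAlg = (Module.finrank ℚ V) ^ 2 := by
  have hn0 : n ≠ 0 := by rw [hn]; exact one_ne_zero
  have hne' : ¬ H.hodgeLie ≤ Subalgebra.toSubmodule H.endAlg := fun h => hne ((hodgeLie_le_endAlg_iff H).1 h)
  have hle := finrank_hodgeLie_add_one_le_mtRank H ψ hn0
  have h3 : Module.finrank ℚ H.hodgeLie ≤ 3 := by omega
  have h3eq := finrank_hodgeLie_eq_three H hne' h3
  exact ⟨h3eq, by omega, four_mul_finrank_endAlg_eq_sq H ψ hn hH hne' h3⟩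

/-- **`dim MT(H) ≤ 4` and `𝔪𝔱 ⊄ End_Hdg(V)` ⟹ the centre of `End_Hdg(V)` is `ℚ`** (polarizable effective weight-one
`H`). [cite: MoonenZarhin1999LowDim, §2] -/
theorem exists_eq_smul_one_of_mem_center_endAlg_of_mtRank_le_four [Nontrivial V] (H : HodgeStructure V n)
    (ψ : H.Polarization) (hn : n = 1) (hH : H.IsEffective)
    (hne : ¬ H.mumfordTateLieAlgebra ≤ Subalgebra.toSubmodule H.endAlg) (h4 : H.mtRank ≤ 4)
    {z : Module.End ℚ V} (hz : z ∈ H.endAlg) (hzc : ∀ a ∈ H.endAlg, z * a = a * z) : ∃ q : ℚ, z = q • 1 := by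
  have hn0 : n ≠ 0 := by rw [hn]; exact one_ne_zero
  have hne' : ¬ H.hodgeLie ≤ Subalgebra.toSubmodule H.endAlg := fun h => hne ((hodgeLie_le_endAlg_iff H).1 h)
  have hle := finrank_hodgeLie_add_one_le_mtRank H ψ hn0
  exact exists_eq_smul_one_of_mem_center_endAlg H ψ hn hH hne' (by omega) hz hzc

end HodgeStructure

end Literature.AlgebraicGeometry.Motives

end
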